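import Literature.AlgebraicGeometry.AbelianVarieties.RelativeFourierExchange
import HarnessLib

/-!
# The relative translation row `D⁺((1_A × t_b)^*) ⋙ (id × Ψ_K) ≅ (id × Ψ_K) ⋙ D⁺(pr_C^*L ⊗ –)` for the relative integral transform
# `id_A × Ψ_K : D⁺(Mod 𝒪_{A×B}) ⥤ D⁺(Mod 𝒪_{A×C})`: translating the ACTIVE factor becomes a twist (Mukai 1981 (3.1), relative form,
# via the derived projection formula; Markman 2025 §6, §9.3)

Layer `Literature/AlgebraicGeometry/AbelianVarieties`; sequel to `RelativeFourierExchange` (rows (i) `relativeTransform_translationFst_iso` and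
(ii) `relativeTransform_twist_iso` of `id × Ψ_K = relativeIntegralTransformPlus A B C K`, `E• ↦ R(pr₁₃)_*(pr₂₃^*K ⊗ pr₁₂^*E•)` on
`(A × B) × C`, kernel a line bundle `K` on `B × C`) and to `FourierMukaiExchangeTranslation` (§3 there: the DERIVED PROJECTION FORMULA
`derivedProjectionFormulaIso` for a line bundle, and the absolute row `D⁺(t_x^*) ⋙ RŜ ≅ RŜ ⋙ D⁺(P_{x⁻¹} ⊗ –)` whose proof this file
transposes). For complex abelian varieties `A`, `B`, `C`, a point `b` of `B` and a line bundle `L` on `C`, GIVEN a datum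
`φ : (t_b × 1_C)⁻¹^*K ≅ K ⊗ pr_C^*L` on `B × C`, this file PROVES (0 named facts, no instances), as an isomorphism of FUNCTORS:

  **ROW (iii) `relativeTransform_translationSnd_iso : D⁺((1_A × t_b)^*) ⋙ (id × Ψ_K) ≅ (id × Ψ_K) ⋙ D⁺(pr_C^*L ⊗ –)`**

— the row `RelativeFourierExchange` defers ("the rows in which the translation acts on the `B`-factor of the source … need the
projection formula"). Ingredients: §1 the automorphism `σ = 1_A × t_b × 1_C` of `(A × B) × C` with its squares `σ ≫ pr₁₂ = pr₁₂ ≫ (1 × t_b)`,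
`σ⁻¹ ≫ pr₂₃ = pr₂₃ ≫ (t_b × 1)⁻¹`, `σ⁻¹ ≫ pr₁₃ = pr₁₃`; §2 the kernel computation `σ⁻¹^*(pr₂₃^*K) ≅ pr₂₃^*K ⊗ pr₁₃^*(pr_C^*L)` and the
NATURAL isomorphism of kernel functors on ALL of `Mod(𝒪_{A×B})`,
`(1 × t_b)^* ⋙ (pr₂₃^*K ⊗ pr₁₂^*(–)) ≅ (pr₂₃^*K ⊗ pr₁₂^*(–)) ⋙ (pr₁₃^*(pr_C^*L) ⊗ –) ⋙ σ^*` (`Modules/PullbackTensorOfLocallyFree`,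
`Modules/PullbackTensor`, Mathlib `pullbackComp`); §3 the row: `D⁺` of §2 (`Algebra/Homology/RightDerivedFunctorPlusComp`),
`D⁺(σ^*) ⋙ R(pr₁₃)_* ≅ R(pr₁₃)_*` (`Modules/DerivedPushforwardIsoBaseChange`), and the derived projection formula for `pr₁₃` and the line
bundle `pr_C^*L` on `A × C`.

NOT here: the specialisation to Markman's `Φ` (sequel `MarkmanPhiTranslateSnd`); compatibilities between rows; the normalisation of `φ`.
Typed for the cell `pub-hodge-ring2` (library row (N4) of crux 26512's E1 scoping memo); a research route conditional on HC_CM, not a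
corollary — nothing in this file refers to it.

## References

* S. Mukai, *Duality between `D(X)` and `D(X̂)` with its application to Picard sheaves*, Nagoya Math. J. 81 (1981), §3 (3.1)
  p. 158 (`RS ∘ T_x^* ≅ (⊗ P_{−x}) ∘ RS`). [Mukai1981]
* E. Markman, *Cycles on abelian 2n-folds of Weil type from secant sheaves on abelian n-folds*, arXiv:2502.03415 (2025), §6 p. 26
  L34–51, §9.3 p. 71 L46–69. [Markman2025SecantWeil]
* H. Lange, *Abelian Varieties over the Complex Numbers* (2023), §6.1.1 Lemma 6.1.3. [Lange2023AbelianVarietiesComplex]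
* U. Görtz, T. Wedhorn, *Algebraic Geometry II* (2023), Def./Rem. 27.1 (p. 799). [GortzWedhorn2023]
* R. Hartshorne, *Algebraic Geometry* (1977), II Ex. 5.1 (d), III Prop. 9.3, III Ex. 8.3. [Hartshorne1977]
-/

noncomputable section

-- `TopCat.Presheaf`/`Scheme.Modules` are not reducible (as in Mathlib's `AlgebraicGeometry/Modules/Sheaf.lean`).
set_option backward.isDefEq.respectTransparency false

open CategoryTheory CategoryTheory.Limits AlgebraicGeometry MonoidalCategory CartesianMonoidalCategory
open AlgebraicGeometry.Scheme.Modules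

universe w₁ w₂ w₃ u

namespace Literature.AlgebraicGeometry.AbelianVarieties

open Literature.AlgebraicGeometry.Motives Literature.AlgebraicGeometry.Modules
open scoped MonObj

/-! ### §1 The automorphism `σ = 1_A × t_b × 1_C` of `(A × B) × C` and its squares -/

section TranslateMid

variable (A B C : AbelianVariety ℂ) (b : B.Points ℂ)

/-- **`1_A × t_b × 1_C` as an isomorphism of schemes of `(A × B) × C`** (`(A ◁ t_b) ▷ C`). [cite: GortzWedhorn2023, Def./Rem. 27.1 (p. 799)] -/
def midTranslationIso₃ : ((A.X ⊗ B.X) ⊗ C.X).left ≅ ((A.X ⊗ B.X) ⊗ C.X).left :=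
  (Over.forget _).mapIso (whiskerRightIso (whiskerLeftIso A.X (B.translationIso b)) C.X)

/-- **`(1 × t_b × 1) ≫ pr₁₂ = pr₁₂ ≫ (1 × t_b)`** on `A × B`. [cite: GortzWedhorn2023, Def./Rem. 27.1 (p. 799)] -/
theorem midTranslation₃_comp_pr₁₂ :
    (midTranslationIso₃ A B C b).hom ≫ (pr₁₂ A B C).left = (pr₁₂ A B C).left ≫ (sndTranslationIso B b A).hom := by
  change ((A.X ◁ B.translation b) ▷ C.X).left ≫ (fst (A.X ⊗ B.X) C.X).left = (fst (A.X ⊗ B.X) C.X).left ≫ (A.X ◁ B.translation b).left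
  rw [← Over.comp_left, ← Over.comp_left, whiskerRight_fst]

/-- **`(1 × t_b × 1)⁻¹ ≫ pr₂₃ = pr₂₃ ≫ (t_b × 1)⁻¹`** on `B × C` (inverses: `t_b⁻¹ = t_{b⁻¹}`). [cite: GortzWedhorn2023, Def./Rem. 27.1 (p. 799)] -/
theorem midTranslation₃_inv_comp_pr₂₃ :
    (midTranslationIso₃ A B C b).inv ≫ (pr₂₃ A B C).left = (pr₂₃ A B C).left ≫ (fstTranslationIso B b C).inv := by
  change ((A.X ◁ B.translation b⁻¹) ▷ C.X).left ≫ (pr₂₃ A B C).left = (pr₂₃ A B C).left ≫ (B.translation b⁻¹ ▷ C.X).left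
  rw [← Over.comp_left, ← Over.comp_left]
  congr 1
  ext <;> simp

/-- **`(1 × t_b × 1)⁻¹ ≫ pr₁₃ = pr₁₃`** (the square over which `R(pr₁₃)_*` is base-changed). [cite: GortzWedhorn2023, Def./Rem. 27.1 (p. 799)] -/
theorem midTranslation₃_inv_comp_pr₁₃ :
    (midTranslationIso₃ A B C b).inv ≫ (pr₁₃ A B C).left = (pr₁₃ A B C).left := by
  change ((A.X ◁ B.translation b⁻¹) ▷ C.X).left ≫ (pr₁₃ A B C).left = (pr₁₃ A B C).left
  rw [← Over.comp_left]
  congr 1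
  ext <;> simp

/-- `pr₂₃ ≫ pr_C = pr₁₃ ≫ pr_C` (both are the third projection). [cite: GortzWedhorn2023, Def./Rem. 27.1 (p. 799)] -/
theorem pr₂₃_comp_snd_eq_pr₁₃_comp_snd :
    (pr₂₃ A B C).left ≫ (snd B.X C.X).left = (pr₁₃ A B C).left ≫ (snd A.X C.X).left := by
  rw [← Over.comp_left, ← Over.comp_left]
  congr 1
  simp only [lift_snd]

/-- `(1 × t_b)^* ⋙ pr₁₂^* ≅ pr₁₂^* ⋙ (1 × t_b × 1)^*` from the square `σ ≫ pr₁₂ = pr₁₂ ≫ (1 × t_b)`. [cite: GortzWedhorn2023, Def./Rem. 27.1 (p. 799)] -/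
def pullbackSndTranslationCompPr₁₂Iso :
    Scheme.Modules.pullback (sndTranslationIso B b A).hom ⋙ Scheme.Modules.pullback (pr₁₂ A B C).left ≅
      Scheme.Modules.pullback (pr₁₂ A B C).left ⋙ Scheme.Modules.pullback (midTranslationIso₃ A B C b).hom :=
  pullbackComp _ _ ≪≫ pullbackCongr (midTranslation₃_comp_pr₁₂ A B C b).symm ≪≫ (pullbackComp _ _).symm

/-- `pr₂₃^*(pr_C^*L) ≅ pr₁₃^*(pr_C^*L)` on the triple product. [cite: GortzWedhorn2023, Def./Rem. 27.1 (p. 799)] -/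
def pullbackPr₂₃SndIso (L : C.X.left.Modules) :
    (Scheme.Modules.pullback (pr₂₃ A B C).left).obj ((Scheme.Modules.pullback (snd B.X C.X).left).obj L) ≅
      (Scheme.Modules.pullback (pr₁₃ A B C).left).obj ((Scheme.Modules.pullback (snd A.X C.X).left).obj L) :=
  (pullbackComp (pr₂₃ A B C).left (snd B.X C.X).left ≪≫ pullbackCongr (pr₂₃_comp_snd_eq_pr₁₃_comp_snd A B C) ≪≫
    (pullbackComp (pr₁₃ A B C).left (snd A.X C.X).left).symm).app L

/-- `(1 × t_b × 1)^*` is left exact (pull-back along an isomorphism). [cite: Hartshorne1977, II §5 p. 110] -/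
theorem preservesFiniteLimits_pullback_midTranslation₃ :
    PreservesFiniteLimits (Scheme.Modules.pullback (midTranslationIso₃ A B C b).hom) :=
  preservesFiniteLimits_pullback_of_iso _

end TranslateMid

/-! ### §2 The kernel computation: `pr₂₃^*K ⊗ pr₁₂^*((1 × t_b)^*E) ≅ σ^*(pr₁₃^*(pr_C^*L) ⊗ (pr₂₃^*K ⊗ pr₁₂^*E))` -/

section Kernel

variable (A B C : AbelianVariety ℂ) (K : (B.X ⊗ C.X).left.Modules) (hK : IsFiniteLocallyFree K) (b : B.Points ℂ)
  {L : C.X.left.Modules} (hL : IsFiniteLocallyFree L)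
  (φ : (Scheme.Modules.pullback (fstTranslationIso B b C).inv).obj K ≅
    tensorObj K ((Scheme.Modules.pullback (snd B.X C.X).left).obj L))

/-- `pr₂₃^*K ≅ σ^*(σ⁻¹^*(pr₂₃^*K))` (an automorphism followed by its inverse). [folklore] -/
def pullbackPr₂₃IsoPullbackPullbackInv :
    (Scheme.Modules.pullback (pr₂₃ A B C).left).obj K ≅
      (Scheme.Modules.pullback (midTranslationIso₃ A B C b).hom).obj
        ((Scheme.Modules.pullback (midTranslationIso₃ A B C b).inv).obj ((Scheme.Modules.pullback (pr₂₃ A B C).left).obj K)) :=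
  ((pullbackComp (midTranslationIso₃ A B C b).hom (midTranslationIso₃ A B C b).inv ≪≫
      pullbackCongr (midTranslationIso₃ A B C b).hom_inv_id ≪≫ pullbackId _).app
    ((Scheme.Modules.pullback (pr₂₃ A B C).left).obj K)).symm

include hK hL in
/-- **The translated kernel is the twisted kernel: `σ⁻¹^*(pr₂₃^*K) ≅ pr₂₃^*K ⊗ pr₁₃^*(pr_C^*L)`** (from `σ⁻¹ ≫ pr₂₃ = pr₂₃ ≫ (t_b × 1)⁻¹`,
`pr₂₃^*` of the datum `φ : (t_b × 1)⁻¹^*K ≅ K ⊗ pr_C^*L`, `pullbackTensorIso`, and `pr₂₃ ≫ pr_C = pr₁₃ ≫ pr_C`).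
[cite: Mukai1981, §3 p. 158 L6–8] -/
def translatedKernelIso :
    (Scheme.Modules.pullback (midTranslationIso₃ A B C b).inv).obj ((Scheme.Modules.pullback (pr₂₃ A B C).left).obj K) ≅
      tensorObj ((Scheme.Modules.pullback (pr₂₃ A B C).left).obj K)
        ((Scheme.Modules.pullback (pr₁₃ A B C).left).obj ((Scheme.Modules.pullback (snd A.X C.X).left).obj L)) :=
  ((pullbackComp (midTranslationIso₃ A B C b).inv (pr₂₃ A B C).left ≪≫
      pullbackCongr (midTranslation₃_inv_comp_pr₂₃ A B C b) ≪≫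
      (pullbackComp (pr₂₃ A B C).left (fstTranslationIso B b C).inv).symm).app K) ≪≫
    (Scheme.Modules.pullback (pr₂₃ A B C).left).mapIso φ ≪≫
    pullbackTensorIso (pr₂₃ A B C).left hK (hL.pullback _) ≪≫
    ((tensorBifunctor _).obj ((Scheme.Modules.pullback (pr₂₃ A B C).left).obj K)).mapIso (pullbackPr₂₃SndIso A B C L)

include hK hL in
/-- **Kernel functor, row (iii)**: `pr₂₃^*K ⊗ pr₁₂^*((1 × t_b)^*E) ≅ σ^*(pr₁₃^*(pr_C^*L) ⊗ (pr₂₃^*K ⊗ pr₁₂^*E))`, naturally on ALL of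
`Mod(𝒪_{A×B})` — `(1 × t_b)^* ⋙ (pr₂₃^*K ⊗ pr₁₂^*(–)) ≅ (pr₂₃^*K ⊗ pr₁₂^*(–)) ⋙ (pr₁₃^*(pr_C^*L) ⊗ –) ⋙ σ^*`.
[cite: Mukai1981, §3 p. 158 L1–9] [cite: Lange2023AbelianVarietiesComplex, §6.1.1 Lemma 6.1.3] -/
def relativeKernelTranslationSndNatIso :
    Scheme.Modules.pullback (sndTranslationIso B b A).hom ⋙ relativeKernelFunctor A B C K ≅
      relativeKernelFunctor A B C K ⋙
        (tensorBifunctor _).obj ((Scheme.Modules.pullback (pr₁₃ A B C).left).obj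
          ((Scheme.Modules.pullback (snd A.X C.X).left).obj L)) ⋙
        Scheme.Modules.pullback (midTranslationIso₃ A B C b).hom :=
  let p := (pr₁₂ A B C).left
  let σ := midTranslationIso₃ A B C b
  let Kq := (Scheme.Modules.pullback (pr₂₃ A B C).left).obj K
  let Q := (Scheme.Modules.pullback (pr₁₃ A B C).left).obj ((Scheme.Modules.pullback (snd A.X C.X).left).obj L)
  have hKq' : IsFiniteLocallyFree ((Scheme.Modules.pullback σ.inv).obj Kq) := (hK.pullback _).pullback _
  -- `(1 × t_b)^* ⋙ p^* ⋙ (Kq ⊗ –) ≅ p^* ⋙ σ^* ⋙ (Kq ⊗ –)`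
  (Functor.associator _ _ _).symm ≪≫
    Functor.isoWhiskerRight (pullbackSndTranslationCompPr₁₂Iso A B C b) _ ≪≫
    Functor.associator _ _ _ ≪≫
    -- `≅ p^* ⋙ σ^* ⋙ (σ^*(σ⁻¹^*Kq) ⊗ –) ≅ p^* ⋙ (σ⁻¹^*Kq ⊗ –) ⋙ σ^* ≅ p^* ⋙ ((Kq ⊗ Q) ⊗ –) ⋙ σ^* ≅ p^* ⋙ (Kq ⊗ –) ⋙ (Q ⊗ –) ⋙ σ^*`
    Functor.isoWhiskerLeft (Scheme.Modules.pullback p)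
      (Functor.isoWhiskerLeft (Scheme.Modules.pullback σ.hom)
          ((tensorBifunctor _).mapIso (pullbackPr₂₃IsoPullbackPullbackInv A B C K b)) ≪≫
        (pullbackTensorNatIsoOfLeft σ.hom hKq').symm ≪≫
        Functor.isoWhiskerRight ((tensorBifunctor _).mapIso (translatedKernelIso A B C K hK b hL φ) ≪≫
          tensorLeftTensorIsoComp Kq Q) (Scheme.Modules.pullback σ.hom) ≪≫
        Functor.associator _ _ _) ≪≫
    (Functor.associator _ _ _).symm

end Kernel

/-! ### §3 ROW (iii): `D⁺((1_A × t_b)^*) ⋙ (id × Ψ_K) ≅ (id × Ψ_K) ⋙ D⁺(pr_C^*L ⊗ –)` -/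

section RowSnd

variable (A B C : AbelianVariety ℂ) (K : (B.X ⊗ C.X).left.Modules) (hK : IsFiniteLocallyFree K) (hK₁ : HasRank K 1)
  (b : B.Points ℂ) {L : C.X.left.Modules} (hL : IsFiniteLocallyFree L) (hL₁ : HasRank L 1)
  (φ : (Scheme.Modules.pullback (fstTranslationIso B b C).inv).obj K ≅
    tensorObj K ((Scheme.Modules.pullback (snd B.X C.X).left).obj L))
  [HasDerivedCategory.{w₁} (A.X ⊗ B.X).left.Modules] [HasDerivedCategory.{w₂} ((A.X ⊗ B.X) ⊗ C.X).left.Modules]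
  [HasDerivedCategory.{w₃} (A.X ⊗ C.X).left.Modules]

/-- **ROW (iii): `D⁺((1_A × t_b)^*) ⋙ (id × Ψ_K) ≅ (id × Ψ_K) ⋙ D⁺(pr_C^*L ⊗ –)`** as functors `D⁺(Mod 𝒪_{A×B}) ⥤ D⁺(Mod 𝒪_{A×C})`,
for a line bundle `L` on `C`, GIVEN `φ : (t_b × 1_C)⁻¹^*K ≅ K ⊗ pr_C^*L` — translating the ACTIVE factor `B` of the source becomes,
after the relative transform, the twist by `pr_C^*L` (the relative form of Mukai's translation row). Proof: `D⁺` of the kernel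
row `relativeKernelTranslationSndNatIso`, then `D⁺(σ^*) ⋙ R(pr₁₃)_* ≅ R(pr₁₃)_*` (base change along `σ⁻¹ ≫ pr₁₃ = pr₁₃`), then the
derived projection formula `derivedProjectionFormulaIso` for `pr₁₃` and the line bundle `pr_C^*L`. Exactness instances of `(1 × t_b)^*`
and `pr_C^*L ⊗ –` are binders (`preservesFiniteLimits_pullback_sndTranslation`, `isInvertibleModule_of_hasRank_one`).
[cite: Mukai1981, §3 (3.1) p. 158 (RS ∘ T_x^* ≅ (⊗ P_{−x}) ∘ RS)] [cite: Markman2025SecantWeil, §9.3 p. 71 L46–69]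
[cite: Hartshorne1977, III Prop. 9.3 and III Ex. 8.3] -/
def relativeTransform_translationSnd_iso
    [PreservesFiniteLimits (Scheme.Modules.pullback (sndTranslationIso B b A).hom)]
    [((tensorBifunctor (A.X ⊗ C.X).left).obj ((Scheme.Modules.pullback (snd A.X C.X).left).obj L)).Additive]
    [PreservesFiniteLimits ((tensorBifunctor (A.X ⊗ C.X).left).obj ((Scheme.Modules.pullback (snd A.X C.X).left).obj L))]
    [PreservesFiniteColimits ((tensorBifunctor (A.X ⊗ C.X).left).obj ((Scheme.Modules.pullback (snd A.X C.X).left).obj L))] :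
    (Scheme.Modules.pullback (sndTranslationIso B b A).hom).mapDerivedCategoryPlus ⋙
        relativeIntegralTransformPlus A B C K hK hK₁ ≅
      relativeIntegralTransformPlus A B C K hK hK₁ ⋙
        ((tensorBifunctor (A.X ⊗ C.X).left).obj ((Scheme.Modules.pullback (snd A.X C.X).left).obj L)).mapDerivedCategoryPlus := by
  haveI := preservesFiniteLimits_pullback_pr₁₂ A B C
  haveI := preservesFiniteLimits_tensor_pullback_pr₂₃ A B C K hK hK₁
  haveI := preservesFiniteColimits_tensor_pullback_pr₂₃ A B C K hK hK₁
  haveI := additive_integralKernelFunctor (pr₁₂ A B C).left ((Scheme.Modules.pullback (pr₂₃ A B C).left).obj K)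
  haveI := preservesFiniteLimits_integralKernelFunctor (pr₁₂ A B C).left ((Scheme.Modules.pullback (pr₂₃ A B C).left).obj K)
  haveI := preservesFiniteColimits_integralKernelFunctor (pr₁₂ A B C).left ((Scheme.Modules.pullback (pr₂₃ A B C).left).obj K)
  haveI := preservesFiniteLimits_pullback_midTranslation₃ A B C b
  let σ := midTranslationIso₃ A B C b
  let q := (pr₁₃ A B C).left
  let L' := (Scheme.Modules.pullback (snd A.X C.X).left).obj L
  have hL' : IsFiniteLocallyFree L' := hL.pullback _
  have hL'₁ : HasRank L' 1 := hasRank_pullback _ hL₁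
  let T := (tensorBifunctor ((A.X ⊗ B.X) ⊗ C.X).left).obj ((Scheme.Modules.pullback q).obj L')
  haveI : T.Additive := additive_tensorBifunctor_obj _
  haveI : PreservesFiniteLimits T :=
    (isInvertibleModule_of_hasRank_one (hL'.pullback q) (hasRank_pullback q hL'₁)).preservesFiniteLimits
  haveI : PreservesFiniteColimits T :=
    (isInvertibleModule_of_hasRank_one (hL'.pullback q) (hasRank_pullback q hL'₁)).preservesFiniteColimits
  haveI := preservesFiniteLimits_pushforward_inv_of_iso σ
  haveI := preservesFiniteColimits_pushforward_inv_of_iso σ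
  let G := relativeKernelFunctor A B C K
  let s := Scheme.Modules.pullback (sndTranslationIso B b A).hom
  let e := Scheme.Modules.pullback σ.hom
  -- `D⁺(σ^*) ⋙ Rq_* ≅ D⁺((σ⁻¹)_*) ⋙ Rq_* ≅ R(σ⁻¹ ≫ q)_* ≅ Rq_*`
  let bc : e.mapDerivedCategoryPlus ⋙ derivedPushforwardPlus q ≅ derivedPushforwardPlus q :=
    Functor.isoWhiskerRight (Functor.mapDerivedCategoryPlusIsoOfIso _ _ (pullbackIsoPushforwardInv σ)) _ ≪≫
      derivedPushforwardPlusIsoCompIso σ.symm q ≪≫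
      Functor.rightDerivedFunctorPlusIsoOfIso _ _ (pushforwardCongr (midTranslation₃_inv_comp_pr₁₃ A B C b))
  -- `D⁺(s) ⋙ D⁺(G) ⋙ Rq_* ≅ D⁺(s ⋙ G) ⋙ Rq_* ≅ D⁺(G ⋙ T ⋙ e) ⋙ Rq_* ≅ D⁺(G) ⋙ D⁺(T) ⋙ (D⁺(e) ⋙ Rq_*) ≅ … ≅ D⁺(G) ⋙ Rq_* ⋙ D⁺(L' ⊗ –)`
  exact (Functor.associator _ _ _).symm ≪≫
    Functor.isoWhiskerRight ((Functor.mapDerivedCategoryPlusCompIso s G).symm ≪≫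
      Functor.mapDerivedCategoryPlusIsoOfIso _ _ (relativeKernelTranslationSndNatIso A B C K hK b hL φ) ≪≫
      Functor.mapDerivedCategoryPlusCompIso G (T ⋙ e) ≪≫
      Functor.isoWhiskerLeft G.mapDerivedCategoryPlus (Functor.mapDerivedCategoryPlusCompIso T e))
      (derivedPushforwardPlus q) ≪≫
    Functor.associator _ _ _ ≪≫
    Functor.isoWhiskerLeft G.mapDerivedCategoryPlus
      (Functor.associator _ _ _ ≪≫ Functor.isoWhiskerLeft T.mapDerivedCategoryPlus bc ≪≫
        derivedProjectionFormulaIso q hL' hL'₁) ≪≫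
    (Functor.associator _ _ _).symm

end RowSnd

end Literature.AlgebraicGeometry.AbelianVarieties

end
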